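import Literature.NumberTheory.EllipticCurves.ModularSymbolsHeckeProofs
import HarnessLib

set_option autoImplicit false

/-!
# Crux `PrintCFram.BottomClassIndexLawFiveLe` (stmt-BirchSwinnertonDyer-20372), line `eisenstein-resource-bdp-line` (registry v27):
# the typing of `stub_flipRung`, piece T3 — THE SLASH COMPUTATION AT THE FLIPPED CUSP (integral-weight vehicle form)
# (cell `bsd-print-cfram`, width seat `bsd-line-cfram-p1-w4` g19; THEOREMS ONLY, `--supports` 20372; BSD is not proved by any of this)

HONEST FRAMING. Pure bookkeeping about functions on `ℍ`, slash operators and `q`-series; nothing here is a statement about elliptic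
curves, Bernoulli numbers or BSD; no registered stub is closed. This is piece T3 of the typing item of LEAD g14's flipped-cusp rung
(crux notes `Lines/eisenstein-resource-bdp-line-lead-g14.md` §2.1, numerically certified there): the expansion of the twisted form
`V = (1/q²) Σ_{j mod q²} h(j) F₀(· + j/q²)` at the cusp `a/M` of the vehicle `F₀` (weight `k`, invariant under `Γ₀(Mq²) ⊓ Γ₁(M)`,
`q ∤ M`), read through `ω₀ = [a b; M D] ∈ SL₂(ℤ)` with `q⁴ ∣ D`, `D ≡ q² (mod M)` (so that LEAD's `W_Q = ω₀·diag(q⁴,1)`, but with the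
lower-right entry `≡ q²`: then every matrix `γ_j` below is `≡ 1 (mod M)` on the diagonal and ONLY `Γ₁`-type invariance is used at
the primes of `M` — the square-class invariance of the cut weights of lead-g14 §2.5 is not needed).

* §1 THE MATRIX CORE (T2 in my orientation; w2 g14's `…FlipRungMatrix` T2 is the `D = q⁴` twin): for a unit `j mod q²` and integers
  `y, c` with `b − y·j·M = q²·c`, the matrix `γ_j = [q²a + jM, c − ya + jd₀; q²M, q²d₀ − yM]` (`D = q⁴d₀`) has determinant `1`, lies in
  `Γ₀(Mq²) ⊓ Γ₁(M)` when `M ∣ q²d₀ − 1`, and `γ_j • (w/q⁴ + y/q²) = ω₀ • w + j/q²` with `denom = (Mw + D)/q²`.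
* §2 (A) THE DECOMPOSITION `(V ∣_k ω₀)(w) = q^{−2k−2} Σ_{j unit} h(j) F₀(w/q⁴ + y_j/q²) + q⁻² Σ_{j non-unit} h(j) (F₀ ∣_k (τ(j/q²)·ω₀))(w)`.
* §3 (B) THE MAIN TERM AS A q-SERIES in `𝕢_{q⁴}(w) = e(w/q⁴)`: coefficients `c₀(n) · S(n)`, `S(n) = Σ_{j unit} h(j) e(n y_j/q²)`
  (T1, w6 g9, evaluates `S`: `0` for `q ∤ n`, `(q/2)(1 + σ q (−u/q))` at `n = qu` for the Legendre weights `h = h_σ`).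
* §4 (C) THE JUNK IS `q²`-PERIODIC: `(F₀ ∣_k (τ(j₁/q)·ω₀)) ∣_k τ(q²) = F₀ ∣_k (τ(j₁/q)·ω₀)` — because `ω₀ τ(q²) ω₀⁻¹` and its
  `τ(j₁/q)`-conjugate `[1 − q²aM − j₁qM², (qa + j₁M)²; −q²M², 1 + q²aM + j₁qM²]` lie in `Γ₀(Mq²) ⊓ Γ₁(M)`.
The coefficient corollary (D) — junk coefficients die off the multiples of `q`, so the coefficient of `e(u w/q³)`, `q ∤ u`, in
`V ∣_k ω₀` is `q^{−2k−2} c₀(qu) S(qu)` — is the sequel file `…FlipRungSlashCoeff`. beyond-print theorem: NO.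

References: [Shimura1971] Prop. 3.64 (translates and twists); [DiamondShurman2005] §1.2 (weight-`k` operators); [Katz1973] §1.6
(the consumer, via NF-Q in T4); crux notes lead-g14 §2.1–2.5.
-/

-- summit-side namespace `Summit.BirchSwinnertonDyer.BirchSwinnertonDyer.…` (single-conjunct summit, D-0017 layout)
set_option linter.dupNamespace false

noncomputable section

open scoped MatrixGroups ModularForm Real Classical
open UpperHalfPlane hiding I
open Complex Matrix.GeneralLinearGroup CongruenceSubgroup Function
open Literature.NumberTheory.EllipticCurves.ModularForms (slash_upperRightHom_apply upperRightHom_smul qParam_vadd)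

namespace Summit.BirchSwinnertonDyer.BirchSwinnertonDyer.Theorems.PrintCFram.FlipRung

/-! ## §1 The matrix core: `τ(j/q²) · ω₀ · diag(q⁴,1) = γ_j · τ(y_j/q²) · diag(q⁴,1)` read on `ℍ` -/

/-- **Determinant of `γ_j`.** For integers with `a·(q⁴d₀) − b·M = 1` (the determinant of `ω₀ = [a b; M q⁴d₀]`) and
`b − y·j·M = q²·c`: `det [q²a + jM, c − ya + jd₀; q²M, q²d₀ − yM] = 1`. [folklore] -/
theorem det_gammaJ_dZero_eq_one {q a b M d₀ j y c : ℤ} (hdet : a * (q ^ 4 * d₀) - b * M = 1) (hc : b - y * j * M = q ^ 2 * c) :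
    Matrix.det !![q ^ 2 * a + j * M, c - y * a + j * d₀; q ^ 2 * M, q ^ 2 * d₀ - y * M] = 1 := by
  rw [Matrix.det_fin_two_of]
  linear_combination hdet + M * hc

/-- **The Möbius identity behind the flipped cusp** (as complex numbers). With `D = q⁴d₀`, `b − y·j·M = q²·c`, `q ≠ 0` and
`M w + D ≠ 0` (no determinant condition is needed for the identity itself): `γ_j` applied to `w/q⁴ + y/q²` is `(a w + b)/(M w + D) + j/q²`, and its denominator there is `(Mw + D)/q²`.
[cite: DiamondShurman2005, §1.2] -/
theorem gammaJ_moebius_eq {q a b M d₀ j y c : ℂ} {w : ℂ} (hq : q ≠ 0)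
    (hc : b - y * j * M = q ^ 2 * c) (hw : M * w + q ^ 4 * d₀ ≠ 0) :
    ((q ^ 2 * a + j * M) * (w / q ^ 4 + y / q ^ 2) + (c - y * a + j * d₀)) /
        ((q ^ 2 * M) * (w / q ^ 4 + y / q ^ 2) + (q ^ 2 * d₀ - y * M)) =
      (a * w + b) / (M * w + q ^ 4 * d₀) + j / q ^ 2 ∧
    (q ^ 2 * M) * (w / q ^ 4 + y / q ^ 2) + (q ^ 2 * d₀ - y * M) = (M * w + q ^ 4 * d₀) / q ^ 2 := by
  have hq2 : q ^ 2 ≠ 0 := pow_ne_zero 2 hq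
  have hq4 : q ^ 4 ≠ 0 := pow_ne_zero 4 hq
  have hden : (q ^ 2 * M) * (w / q ^ 4 + y / q ^ 2) + (q ^ 2 * d₀ - y * M) = (M * w + q ^ 4 * d₀) / q ^ 2 := by
    field_simp
    ring
  refine ⟨?_, hden⟩
  have hnum : (q ^ 2 * a + j * M) * (w / q ^ 4 + y / q ^ 2) + (c - y * a + j * d₀) =
      ((a * w + b) * q ^ 2 + j * (M * w + q ^ 4 * d₀)) / q ^ 4 := by
    have hc' : c = (b - y * j * M) / q ^ 2 := by rw [hc]; field_simp
    rw [hc']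
    field_simp
    ring
  have hw' : w * M + q ^ 4 * d₀ ≠ 0 := by rwa [mul_comm w M]
  rw [hnum, hden]
  field_simp

/-- **The flipped-cusp factorisation read on `ℍ`.** Let `ω₀ = [a b; M q⁴d₀] ∈ SL₂(ℤ)`, `q ≥ 1`, and `γ ∈ SL₂(ℤ)` the matrix
`[q²a + jM, c − ya + jd₀; q²M, q²d₀ − yM]` for integers `j, y, c` with `b − y·j·M = q²·c`. Then for every `w ∈ ℍ`:
`γ • (w/q⁴ + y/q²) = ω₀ • w + j/q²` and `denom γ (w/q⁴ + y/q²) = (M w + q⁴d₀)/q²` — i.e. `τ(j/q²)·ω₀·diag(q⁴,1) = γ·τ(y/q²)·diag(q⁴,1)`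
up to the scalar `q²`. [cite: DiamondShurman2005, §1.2] -/
theorem gammaJ_smul_eq (ω₀ γ : SL(2, ℤ)) {q : ℕ} (hq : q ≠ 0) {M d₀ j y c : ℤ}
    (hM : ω₀ 1 0 = M) (hD : ω₀ 1 1 = (q : ℤ) ^ 4 * d₀) (hc : ω₀ 0 1 - y * j * M = (q : ℤ) ^ 2 * c)
    (h00 : γ 0 0 = (q : ℤ) ^ 2 * ω₀ 0 0 + j * M) (h01 : γ 0 1 = c - y * ω₀ 0 0 + j * d₀)
    (h10 : γ 1 0 = (q : ℤ) ^ 2 * M) (h11 : γ 1 1 = (q : ℤ) ^ 2 * d₀ - y * M) (w : ℍ) :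
    γ • (((y : ℝ) / (q : ℝ) ^ 2) +ᵥ ((⟨((q : ℝ) ^ 4)⁻¹, by positivity⟩ : {x : ℝ // 0 < x}) • w)) =
      ((j : ℝ) / (q : ℝ) ^ 2) +ᵥ (ω₀ • w) ∧
    denom γ (((y : ℝ) / (q : ℝ) ^ 2) +ᵥ ((⟨((q : ℝ) ^ 4)⁻¹, by positivity⟩ : {x : ℝ // 0 < x}) • w)) =
      ((M : ℂ) * w + (q : ℂ) ^ 4 * d₀) / (q : ℂ) ^ 2 := by
  have hqC : (q : ℂ) ≠ 0 := by exact_mod_cast hq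
  have hcC : (ω₀ 0 1 : ℂ) - (y : ℂ) * j * M = (q : ℂ) ^ 2 * c := by exact_mod_cast hc
  have hwden : (M : ℂ) * w + (q : ℂ) ^ 4 * d₀ ≠ 0 := by
    have h := denom_ne_zero ω₀ w
    rw [ModularGroup.denom_apply, hM, hD] at h
    simpa using h
  obtain ⟨hmob, hden⟩ := gammaJ_moebius_eq (a := (ω₀ 0 0 : ℂ)) (b := (ω₀ 0 1 : ℂ)) (M := (M : ℂ)) (d₀ := (d₀ : ℂ))
    (j := (j : ℂ)) (y := (y : ℂ)) (c := (c : ℂ)) (w := (w : ℂ)) hqC hcC hwden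
  -- the point `w/q⁴ + y/q²` as a complex number
  have hpt : ((((y : ℝ) / (q : ℝ) ^ 2) +ᵥ ((⟨((q : ℝ) ^ 4)⁻¹, by positivity⟩ : {x : ℝ // 0 < x}) • w) : ℍ) : ℂ) =
      (w : ℂ) / (q : ℂ) ^ 4 + (y : ℂ) / (q : ℂ) ^ 2 := by
    rw [coe_vadd, coe_pos_real_smul, Complex.real_smul]
    push_cast
    ring
  constructor
  · apply UpperHalfPlane.ext
    rw [coe_vadd, coe_specialLinearGroup_apply, coe_specialLinearGroup_apply, hpt]
    simp only [h00, h01, h10, h11, hM, hD, eq_intCast, Int.cast_add, Int.cast_mul, Int.cast_pow, Int.cast_sub,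
      Int.cast_natCast]
    push_cast
    rw [hmob]
    ring
  · rw [ModularGroup.denom_apply, hpt, h10, h11]
    push_cast
    rw [← hden]

/-! ## §2 (A) The decomposition of `V ∣_k ω₀` into the unit translates (main term) and the non-unit translates (junk) -/

/-- **(A) THE DECOMPOSITION AT THE FLIPPED CUSP.** Let `q` be a prime, `ω₀ = [a b; M q⁴d₀] ∈ SL₂(ℤ)` with `M ∣ q²d₀ − 1`
(so `D = q⁴d₀ ≡ q² (mod M)`), `F₀ : ℍ → ℂ` a weight-`k` function invariant under every `γ ∈ SL₂(ℤ)` with `Mq² ∣ γ₁₀` and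
`M ∣ γ₁₁ − 1` (the group `Γ₀(Mq²) ⊓ Γ₁(M)`), `h : ℤ/q² → ℂ` ANY weights and `V(z) = q⁻² Σ_j h(j) F₀(z + j/q²)` the twisted form,
`y, c : ℤ/q² → ℤ` with `b − y(j)·j·M = q²·c(j)` at every unit `j`. Then for every `w ∈ ℍ`:
`(V ∣_k ω₀)(w) = q⁻²·(q²)^{−k} Σ_{j unit} h(j) F₀(w/q⁴ + y(j)/q²) + q⁻² Σ_{j non-unit} h(j) (F₀ ∣_k (τ(j/q²)·ω₀))(w)`.
The unit translates factor through `γ_j ∈ Γ₀(Mq²) ⊓ Γ₁(M)` (§1) and the automorphy of `F₀`; the non-unit ones are left as slashes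
(they are `q²`-periodic, §4). [cite: Shimura1971, Prop. 3.64] [cite: DiamondShurman2005, §1.2] -/
theorem slash_flippedCusp_decomposition {q : ℕ} [NeZero (q ^ 2)] (hq : q.Prime) (ω₀ : SL(2, ℤ)) {M d₀ : ℤ}
    (hM : ω₀ 1 0 = M) (hD : ω₀ 1 1 = (q : ℤ) ^ 4 * d₀) (hd₀ : M ∣ (q : ℤ) ^ 2 * d₀ - 1)
    {k : ℤ} (F₀ : ℍ → ℂ)
    (hinv : ∀ γ : SL(2, ℤ), M * (q : ℤ) ^ 2 ∣ γ 1 0 → M ∣ γ 1 1 - 1 → F₀ ∣[k] γ = F₀)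
    (h : ZMod (q ^ 2) → ℂ) (V : ℍ → ℂ)
    (hV : ∀ z : ℍ, V z = ((q : ℂ) ^ 2)⁻¹ * ∑ j : ZMod (q ^ 2), h j * F₀ (((j.val : ℝ) / (q : ℝ) ^ 2) +ᵥ z))
    (y c : ZMod (q ^ 2) → ℤ)
    (hyc : ∀ j : ZMod (q ^ 2), IsUnit j → ω₀ 0 1 - y j * (j.val : ℤ) * M = (q : ℤ) ^ 2 * c j) (w : ℍ) :
    (V ∣[k] ω₀) w =
      ((q : ℂ) ^ 2)⁻¹ * ((q : ℂ) ^ 2) ^ (-k) *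
          ∑ j ∈ Finset.univ.filter (fun j : ZMod (q ^ 2) ↦ IsUnit j),
            h j * F₀ (((y j : ℝ) / (q : ℝ) ^ 2) +ᵥ
              ((⟨((q : ℝ) ^ 4)⁻¹, by have := hq.pos; positivity⟩ : {x : ℝ // 0 < x}) • w)) +
        ((q : ℂ) ^ 2)⁻¹ *
          ∑ j ∈ Finset.univ.filter (fun j : ZMod (q ^ 2) ↦ ¬ IsUnit j),
            h j * (F₀ ∣[k] (upperRightHom ((j.val : ℝ) / (q : ℝ) ^ 2) * (ω₀ : GL (Fin 2) ℝ))) w := by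
  have hq0 : q ≠ 0 := hq.ne_zero
  have hqC : (q : ℂ) ≠ 0 := by exact_mod_cast hq0
  have hq2C : (q : ℂ) ^ 2 ≠ 0 := pow_ne_zero 2 hqC
  have hdetZ : ω₀ 0 0 * ((q : ℤ) ^ 4 * d₀) - ω₀ 0 1 * M = 1 := by
    have := Matrix.det_fin_two (ω₀ : Matrix (Fin 2) (Fin 2) ℤ)
    rw [Matrix.SpecialLinearGroup.det_coe, hM, hD] at this
    linear_combination -this
  -- `denom ω₀ w = M w + D ≠ 0`
  have hden0 : denom ω₀ w = (M : ℂ) * w + (q : ℂ) ^ 4 * d₀ := by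
    rw [ModularGroup.denom_apply, hM, hD]; push_cast; ring
  have hwden : (M : ℂ) * w + (q : ℂ) ^ 4 * d₀ ≠ 0 := by rw [← hden0]; exact denom_ne_zero ω₀ w
  -- the unit translates: factor through `γ_j` and use the automorphy of `F₀`
  have hunit : ∀ j : ZMod (q ^ 2), IsUnit j →
      F₀ (((j.val : ℝ) / (q : ℝ) ^ 2) +ᵥ (ω₀ • w)) * denom ω₀ w ^ (-k) =
        ((q : ℂ) ^ 2) ^ (-k) *
          F₀ (((y j : ℝ) / (q : ℝ) ^ 2) +ᵥ
            ((⟨((q : ℝ) ^ 4)⁻¹, by have := hq.pos; positivity⟩ : {x : ℝ // 0 < x}) • w)) := by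
    intro j hj
    set zj : ℍ := ((y j : ℝ) / (q : ℝ) ^ 2) +ᵥ
      ((⟨((q : ℝ) ^ 4)⁻¹, by have := hq.pos; positivity⟩ : {x : ℝ // 0 < x}) • w) with hzj
    let γ : SL(2, ℤ) := ⟨!![(q : ℤ) ^ 2 * ω₀ 0 0 + (j.val : ℤ) * M, c j - y j * ω₀ 0 0 + (j.val : ℤ) * d₀;
        (q : ℤ) ^ 2 * M, (q : ℤ) ^ 2 * d₀ - y j * M], det_gammaJ_dZero_eq_one hdetZ (hyc j hj)⟩
    have h00 : γ 0 0 = (q : ℤ) ^ 2 * ω₀ 0 0 + (j.val : ℤ) * M := rfl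
    have h01 : γ 0 1 = c j - y j * ω₀ 0 0 + (j.val : ℤ) * d₀ := rfl
    have h10 : γ 1 0 = (q : ℤ) ^ 2 * M := rfl
    have h11 : γ 1 1 = (q : ℤ) ^ 2 * d₀ - y j * M := rfl
    obtain ⟨hsmul, hdenj⟩ := gammaJ_smul_eq ω₀ γ hq0 hM hD (hyc j hj) h00 h01 h10 h11 w
    rw [Int.cast_natCast] at hsmul
    -- automorphy of `F₀` under `γ ∈ Γ₀(Mq²) ⊓ Γ₁(M)`
    have hγ : F₀ ∣[k] γ = F₀ := by
      refine hinv γ ?_ ?_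
      · rw [h10]; exact ⟨1, by ring⟩
      · rw [h11]
        have : (q : ℤ) ^ 2 * d₀ - y j * M - 1 = ((q : ℤ) ^ 2 * d₀ - 1) + M * (-y j) := by ring
        rw [this]
        exact dvd_add hd₀ (dvd_mul_right M _)
    have hval := (ModularForm.slash_action_eq'_iff k F₀ γ zj).mp (congrFun hγ zj)
    have hdenj' : ((γ 1 0 : ℤ) : ℂ) * (zj : ℂ) + ((γ 1 1 : ℤ) : ℂ) = ((M : ℂ) * w + (q : ℂ) ^ 4 * d₀) / (q : ℂ) ^ 2 := by
      rw [← hdenj, ModularGroup.denom_apply]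
    rw [← hsmul, hval, hdenj', hden0, div_zpow, mul_comm (_ / _) (F₀ zj), mul_assoc, mul_comm, zpow_neg, zpow_neg,
      div_eq_mul_inv, mul_right_comm (((M : ℂ) * w + (q : ℂ) ^ 4 * d₀) ^ k), mul_inv_cancel₀ (zpow_ne_zero k hwden), one_mul]
  -- the non-unit translates: just slashes
  have hnon : ∀ j : ZMod (q ^ 2),
      F₀ (((j.val : ℝ) / (q : ℝ) ^ 2) +ᵥ (ω₀ • w)) * denom ω₀ w ^ (-k) =
        (F₀ ∣[k] (upperRightHom ((j.val : ℝ) / (q : ℝ) ^ 2) * (ω₀ : GL (Fin 2) ℝ))) w := by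
    intro j
    rw [SlashAction.slash_mul, ← ModularForm.SL_slash, ModularForm.SL_slash_apply, slash_upperRightHom_apply]
  -- assemble
  rw [ModularForm.SL_slash_apply, hV, mul_assoc, Finset.sum_mul,
    ← Finset.sum_filter_add_sum_filter_not Finset.univ (fun j : ZMod (q ^ 2) ↦ IsUnit j), mul_add]
  congr 1
  · rw [mul_assoc]
    congr 1
    rw [Finset.mul_sum]
    refine Finset.sum_congr rfl fun j hj ↦ ?_
    rw [Finset.mem_filter] at hj
    rw [mul_assoc, hunit j hj.2]
    ring
  · congr 1
    refine Finset.sum_congr rfl fun j _ ↦ ?_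
    rw [mul_assoc, hnon j]

/-! ## §3 (B) The main term as a `q`-series in `e(w/q⁴)` -/

/-- `e(z_j) = e(y/q²)·e(w/q⁴)` for the point `z_j = w/q⁴ + y/q²`: the parameter `𝕢₁` at `z_j` is `e^{2πi y/q²}` times the parameter
`𝕢_{q⁴}` at `w`. [folklore] -/
theorem qParam_one_translate_dilate {q : ℕ} (hq : q ≠ 0) (y : ℤ) (w : ℍ) :
    Periodic.qParam 1 ((((y : ℝ) / (q : ℝ) ^ 2) +ᵥ ((⟨((q : ℝ) ^ 4)⁻¹, by positivity⟩ : {x : ℝ // 0 < x}) • w) : ℍ) : ℂ) =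
      cexp (2 * π * I * ((y : ℂ) / (q : ℂ) ^ 2)) * Periodic.qParam ((q : ℝ) ^ 4) (w : ℂ) := by
  have hqC : (q : ℂ) ≠ 0 := by exact_mod_cast hq
  rw [Periodic.qParam, Periodic.qParam, coe_vadd, coe_pos_real_smul, Complex.real_smul, ← Complex.exp_add]
  congr 1
  push_cast
  field_simp

/-- **(B) THE MAIN TERM AS A q-SERIES.** If `F₀(τ) = Σ c₀(n) e(nτ)` on `ℍ`, then for any weights `h` and integers `y(j)`:
`Σ_{j unit} h(j) F₀(w/q⁴ + y(j)/q²) = Σ_n c₀(n)·S(n)·e(n w/q⁴)` with **`S(n) = Σ_{j unit} h(j) e(n·y(j)/q²)`** — the finite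
character sum that T1 (w6 g9) evaluates for the Legendre weights (`0` if `q ∤ n`; `(q/2)(1 + σ q (−u/q))` at `n = qu`).
[cite: Shimura1971, Prop. 3.64] -/
theorem hasSum_flippedCusp_mainTerm {q : ℕ} [NeZero (q ^ 2)] (hq : q.Prime) (F₀ : ℍ → ℂ) (c₀ : ℕ → ℂ)
    (hF₀ : ∀ τ : ℍ, HasSum (fun n : ℕ ↦ c₀ n * Periodic.qParam 1 (τ : ℂ) ^ n) (F₀ τ))
    (h : ZMod (q ^ 2) → ℂ) (y : ZMod (q ^ 2) → ℤ) (w : ℍ) :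
    HasSum (fun n : ℕ ↦ c₀ n *
        (∑ j ∈ Finset.univ.filter (fun j : ZMod (q ^ 2) ↦ IsUnit j),
          h j * cexp (2 * π * I * ((y j : ℂ) / (q : ℂ) ^ 2) * n)) *
        Periodic.qParam ((q : ℝ) ^ 4) (w : ℂ) ^ n)
      (∑ j ∈ Finset.univ.filter (fun j : ZMod (q ^ 2) ↦ IsUnit j),
        h j * F₀ (((y j : ℝ) / (q : ℝ) ^ 2) +ᵥ
          ((⟨((q : ℝ) ^ 4)⁻¹, by have := hq.pos; positivity⟩ : {x : ℝ // 0 < x}) • w))) := by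
  have hq0 : q ≠ 0 := hq.ne_zero
  have key : ∀ j ∈ Finset.univ.filter (fun j : ZMod (q ^ 2) ↦ IsUnit j),
      HasSum (fun n : ℕ ↦ h j * (c₀ n * (cexp (2 * π * I * ((y j : ℂ) / (q : ℂ) ^ 2) * n) *
          Periodic.qParam ((q : ℝ) ^ 4) (w : ℂ) ^ n)))
        (h j * F₀ (((y j : ℝ) / (q : ℝ) ^ 2) +ᵥ
          ((⟨((q : ℝ) ^ 4)⁻¹, by have := hq.pos; positivity⟩ : {x : ℝ // 0 < x}) • w))) := by
    intro j _
    refine HasSum.mul_left (h j) ?_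
    have hs := hF₀ (((y j : ℝ) / (q : ℝ) ^ 2) +ᵥ
      ((⟨((q : ℝ) ^ 4)⁻¹, by have := hq.pos; positivity⟩ : {x : ℝ // 0 < x}) • w))
    refine hs.congr_fun fun n ↦ ?_
    rw [qParam_one_translate_dilate hq0 (y j) w, mul_pow, ← Complex.exp_nat_mul]
    ring_nf
  refine (hasSum_sum key).congr_fun fun n ↦ ?_
  rw [Finset.mul_sum, Finset.sum_mul]
  exact Finset.sum_congr rfl fun j _ ↦ by ring

/-! ## §4 (C) The non-unit translates are `q²`-periodic at the flipped cusp -/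

/-- **The conjugated translation.** For `ω₀ = [a b; M D] ∈ SL₂(ℤ)`, an integer `j₁` and `q`: with `x = j₁/q`,
`τ(x) · ω₀ · τ(q²) = ρ' · τ(x) · ω₀` in `GL₂(ℝ)`, where `ρ' = [1 − q²aM − j₁qM², (qa + j₁M)²; −q²M², 1 + q²aM + j₁qM²] ∈ SL₂(ℤ)`
(`= τ(x) · ω₀ τ(q²) ω₀⁻¹ · τ(−x)`). [cite: DiamondShurman2005, §1.2] -/
theorem translate_mul_mul_translate_sq_eq (ω₀ ρ : SL(2, ℤ)) {q : ℕ} (hq : q ≠ 0) {M : ℤ} (hM : ω₀ 1 0 = M) (j₁ : ℤ)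
    (h00 : ρ 0 0 = 1 - (q : ℤ) ^ 2 * ω₀ 0 0 * M - j₁ * q * M ^ 2) (h01 : ρ 0 1 = ((q : ℤ) * ω₀ 0 0 + j₁ * M) ^ 2)
    (h10 : ρ 1 0 = -((q : ℤ) ^ 2 * M ^ 2)) (h11 : ρ 1 1 = 1 + (q : ℤ) ^ 2 * ω₀ 0 0 * M + j₁ * q * M ^ 2) :
    upperRightHom ((j₁ : ℝ) / q) * (ω₀ : GL (Fin 2) ℝ) * upperRightHom ((q : ℝ) ^ 2) =
      (ρ : GL (Fin 2) ℝ) * (upperRightHom ((j₁ : ℝ) / q) * (ω₀ : GL (Fin 2) ℝ)) := by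
  have hdet : ω₀ 0 0 * ω₀ 1 1 - ω₀ 0 1 * ω₀ 1 0 = 1 := by
    have := Matrix.det_fin_two (ω₀ : Matrix (Fin 2) (Fin 2) ℤ)
    rw [Matrix.SpecialLinearGroup.det_coe] at this
    linear_combination -this
  have hdetR : ((ω₀ 0 0 : ℤ) : ℝ) * ((ω₀ 1 1 : ℤ) : ℝ) - ((ω₀ 0 1 : ℤ) : ℝ) * M = 1 := by
    rw [← hM]; exact_mod_cast hdet
  have hqR : (q : ℝ) ≠ 0 := by exact_mod_cast hq
  have hMR : ((ω₀ 1 0 : ℤ) : ℝ) = M := by exact_mod_cast hM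
  have h00R : ((ρ 0 0 : ℤ) : ℝ) = 1 - (q : ℝ) ^ 2 * ((ω₀ 0 0 : ℤ) : ℝ) * M - j₁ * q * (M : ℝ) ^ 2 := by exact_mod_cast h00
  have h01R : ((ρ 0 1 : ℤ) : ℝ) = ((q : ℝ) * ((ω₀ 0 0 : ℤ) : ℝ) + j₁ * M) ^ 2 := by exact_mod_cast h01
  have h10R : ((ρ 1 0 : ℤ) : ℝ) = -((q : ℝ) ^ 2 * (M : ℝ) ^ 2) := by exact_mod_cast h10
  have h11R : ((ρ 1 1 : ℤ) : ℝ) = 1 + (q : ℝ) ^ 2 * ((ω₀ 0 0 : ℤ) : ℝ) * M + j₁ * q * (M : ℝ) ^ 2 := by exact_mod_cast h11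
  refine Units.ext ?_
  ext i hi
  fin_cases i <;> fin_cases hi <;>
    simp [Matrix.mul_apply, Fin.sum_univ_two, upperRightHom, Matrix.vecMul, dotProduct, Matrix.map_apply,
      hMR, h00R, h01R, h10R, h11R] <;>
    field_simp
  · ring
  · linear_combination (-((q : ℝ) ^ 2 * j₁ * M + (q : ℝ) ^ 3 * ((ω₀ 0 0 : ℤ) : ℝ))) * hdetR
  · ring
  · linear_combination (-((q : ℝ) ^ 2 * M)) * hdetR

/-- **(C) THE NON-UNIT TRANSLATES ARE `q²`-PERIODIC AT THE FLIPPED CUSP.** For `ω₀ = [a b; M D] ∈ SL₂(ℤ)`, a weight-`k` function `F₀`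
invariant under every `γ ∈ SL₂(ℤ)` with `Mq² ∣ γ₁₀`, `M ∣ γ₁₁ − 1`, and an integer `j₁`:
`(F₀ ∣_k (τ(j₁/q)·ω₀)) ∣_k τ(q²) = F₀ ∣_k (τ(j₁/q)·ω₀)` — the matrix `ρ'` of `translate_mul_mul_translate_sq_eq` has lower-left
entry `−q²M²` and diagonal `≡ 1 (mod M)`. So the junk of the decomposition (A) is a `q²`-periodic function of `w`.
[cite: DiamondShurman2005, §1.2] -/
theorem slash_translate_flippedCusp_periodic (ω₀ : SL(2, ℤ)) {q : ℕ} (hq : q ≠ 0) {M : ℤ} (hM : ω₀ 1 0 = M)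
    {k : ℤ} (F₀ : ℍ → ℂ)
    (hinv : ∀ γ : SL(2, ℤ), M * (q : ℤ) ^ 2 ∣ γ 1 0 → M ∣ γ 1 1 - 1 → F₀ ∣[k] γ = F₀) (j₁ : ℤ) :
    (F₀ ∣[k] (upperRightHom ((j₁ : ℝ) / q) * (ω₀ : GL (Fin 2) ℝ))) ∣[k] upperRightHom ((q : ℝ) ^ 2) =
      F₀ ∣[k] (upperRightHom ((j₁ : ℝ) / q) * (ω₀ : GL (Fin 2) ℝ)) := by
  -- the conjugated translation `ρ'`
  let ρ : SL(2, ℤ) := ⟨!![1 - (q : ℤ) ^ 2 * ω₀ 0 0 * M - j₁ * q * M ^ 2, ((q : ℤ) * ω₀ 0 0 + j₁ * M) ^ 2;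
      -((q : ℤ) ^ 2 * M ^ 2), 1 + (q : ℤ) ^ 2 * ω₀ 0 0 * M + j₁ * q * M ^ 2], by
    rw [Matrix.det_fin_two_of]; ring⟩
  have hρ : F₀ ∣[k] ρ = F₀ := by
    refine hinv ρ ⟨-M, ?_⟩ ⟨(q : ℤ) ^ 2 * ω₀ 0 0 + j₁ * q * M, ?_⟩
    · show -((q : ℤ) ^ 2 * M ^ 2) = M * (q : ℤ) ^ 2 * -M
      ring
    · show 1 + (q : ℤ) ^ 2 * ω₀ 0 0 * M + j₁ * q * M ^ 2 - 1 = M * ((q : ℤ) ^ 2 * ω₀ 0 0 + j₁ * q * M)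
      ring
  have hmat := translate_mul_mul_translate_sq_eq ω₀ ρ hq hM j₁ rfl rfl rfl rfl
  rw [← SlashAction.slash_mul, hmat, SlashAction.slash_mul, ← ModularForm.SL_slash, hρ]

/-- For a prime `q`, a NON-unit `j ∈ ℤ/q²` has `q ∣ j` (on the representative in `[0, q²)`), so its translate `j/q²` is `j₁/q`
with `j₁ = j/q`. [folklore] -/
theorem val_div_sq_eq_of_not_isUnit {q : ℕ} [NeZero (q ^ 2)] (hq : q.Prime) {j : ZMod (q ^ 2)} (hj : ¬ IsUnit j) :
    q ∣ j.val ∧ ((j.val : ℝ) / (q : ℝ) ^ 2) = (((j.val / q : ℕ) : ℤ) : ℝ) / q := by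
  have hdvd : q ∣ j.val := by
    by_contra hnd
    apply hj
    have hcop : j.val.Coprime (q ^ 2) := Nat.Coprime.pow_right 2 ((Nat.Prime.coprime_iff_not_dvd hq).mpr hnd).symm
    have := (ZMod.isUnit_iff_coprime j.val (q ^ 2)).mpr hcop
    rwa [ZMod.natCast_zmod_val] at this
  refine ⟨hdvd, ?_⟩
  obtain ⟨t, ht⟩ := hdvd
  have hq0 : (q : ℝ) ≠ 0 := by exact_mod_cast hq.ne_zero
  rw [ht, Nat.mul_div_cancel_left t hq.pos]
  push_cast
  field_simp

/-- **(C') in the indexing of (A):** for a prime `q` and a NON-unit `j ∈ ℤ/q²`, the translate slash `F₀ ∣_k (τ(j/q²)·ω₀)` of the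
decomposition is `q²`-periodic. [cite: DiamondShurman2005, §1.2] -/
theorem slash_translate_flippedCusp_periodic_of_not_isUnit {q : ℕ} [NeZero (q ^ 2)] (hq : q.Prime) (ω₀ : SL(2, ℤ)) {M : ℤ}
    (hM : ω₀ 1 0 = M) {k : ℤ} (F₀ : ℍ → ℂ)
    (hinv : ∀ γ : SL(2, ℤ), M * (q : ℤ) ^ 2 ∣ γ 1 0 → M ∣ γ 1 1 - 1 → F₀ ∣[k] γ = F₀)
    {j : ZMod (q ^ 2)} (hj : ¬ IsUnit j) :
    (F₀ ∣[k] (upperRightHom ((j.val : ℝ) / (q : ℝ) ^ 2) * (ω₀ : GL (Fin 2) ℝ))) ∣[k] upperRightHom ((q : ℝ) ^ 2) =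
      F₀ ∣[k] (upperRightHom ((j.val : ℝ) / (q : ℝ) ^ 2) * (ω₀ : GL (Fin 2) ℝ)) := by
  rw [(val_div_sq_eq_of_not_isUnit hq hj).2]
  exact slash_translate_flippedCusp_periodic ω₀ hq.ne_zero hM F₀ hinv _

end Summit.BirchSwinnertonDyer.BirchSwinnertonDyer.Theorems.PrintCFram.FlipRung

end
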